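import Mathlib
import HarnessLib
import Summits.NavierStokesRegularity.NavierStokesRegularity.Theorems.LocalSineTubeDoorMostTimesCrossDoor
import Summits.NavierStokesRegularity.NavierStokesRegularity.Theorems.LocalSineTubeDoorProfileAlignedWindowRigidity
import Summits.NavierStokesRegularity.NavierStokesRegularity.Theorems.PoloidalWindowDoorPoloidalWindowRigidityFlat

/-!
# The BAND single-point door template and the MOST-TIMES fixed-direction sine door (unconditional)

Cell ns-regularity-ideate, seat p6 (`--supports stmt-NavierStokesRegularity-20017`; rung N0-LocalTubeDoorSine neighbourhood).
Single-point companion of `…MostTimesCrossDoor`: the abstract time hypothesis of `…BandZoom.bandWindowZoom` (a predicate `P` on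
times meeting every parabolic scale band at `T`, window scalar fading along every sequence of `P`-times → T) for doors whose
profile crux is ONE-SLICE:

* `bandDoor_of_oneSliceWindowRigidity` — the template (any continuous `F(x, A)` with scaling-invariant zero set);
* `mostTimesFixedDirectionDoor` — **UNCONDITIONAL:** classical Leray–Hopf from rapidly decaying data, LOCAL Type I at `(x₀,T)`,
  `e ≠ 0`, `U` nonempty open, an exceptional set of times `E` of density → 0 at `T` such that
  `∫_U ‖(T−t) curl u(t, x₀+√(T−t)y) × e‖ dy → 0` along every sequence of times `t ∉ E`, `t → T` ⇒ `u` stays bounded near `x₀`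
  up to `T` (one-slice crux `eq_zero_of_aligned_window`).

WHAT THIS IS NOT: not a claim about Navier–Stokes regularity (Clay A) — local, conditional-on-Type-I regularity CRITERIA;
establishment in the cell's sense needs the cross-family referee PASS + independent reproduction (bears_on LADDER-NS N0).
-/

noncomputable section

-- the summit and its single sub-problem share the name (CONVENTIONS §1), as in every Theorems file
set_option linter.dupNamespace false

namespace Summit.NavierStokesRegularity.NavierStokesRegularity.Theorems.LocalSineTubeDoorMostTimesFixedDirectionDoor

open MeasureTheory Set Function Filter Topology TopologicalSpace Metric
open scoped RealInnerProductSpace InnerProductSpace NNReal ENNReal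
open Literature.Analysis Literature.Analysis.FluidPDE
open Summit.NavierStokesRegularity.NavierStokesRegularity.Theorems.LocalSineTubeDoorProfileAlignedWindowRigidityAncient
open Summit.NavierStokesRegularity.NavierStokesRegularity.Theorems.LocalSineTubeDoorProfileAlignedWindowRigidity
open Summit.NavierStokesRegularity.NavierStokesRegularity.Theorems.PoloidalWindowDoorPoloidalWindowRigidityFlat
open Summit.NavierStokesRegularity.NavierStokesRegularity.Theorems.LocalSineTubeDoorBandZoom
open Summit.NavierStokesRegularity.NavierStokesRegularity.Theorems.LocalSineTubeDoorMostTimesCrossDoor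

/-- **BAND SINGLE-POINT DOOR TEMPLATE (one-slice cruxes).**  See the module docstring. -/
theorem bandDoor_of_oneSliceWindowRigidity
    (F : (EuclideanSpace ℝ (Fin 3)) → ((EuclideanSpace ℝ (Fin 3)) →L[ℝ] (EuclideanSpace ℝ (Fin 3))) → ℝ)
    (hF : Continuous fun q : (EuclideanSpace ℝ (Fin 3)) × ((EuclideanSpace ℝ (Fin 3)) →L[ℝ] (EuclideanSpace ℝ (Fin 3))) => F q.1 q.2)
    (hzero : ∀ (a b : ℝ), 0 < a → 0 < b → ∀ (x : (EuclideanSpace ℝ (Fin 3))) (A : (EuclideanSpace ℝ (Fin 3)) →L[ℝ] (EuclideanSpace ℝ (Fin 3))), F (a • x) (b • A) = 0 ↔ F x A = 0)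
    (hcrux : ∀ (C : ℝ) (v : ℝ → (EuclideanSpace ℝ (Fin 3)) → (EuclideanSpace ℝ (Fin 3))),
      Literature.Analysis.FluidPDE.HasTypeITimeDecay C v →
      ContinuousOn (Function.uncurry v) (Set.Iio (0 : ℝ) ×ˢ Set.univ) →
      (∀ s t : ℝ, s < t → t < 0 → ∀ x, v t x =
        Literature.Analysis.UnboundedOperators.heatExtension (v s) (t - s) x -
          Literature.Analysis.FluidPDE.oseenDuhamel 1 s v v t x) →
      (∀ t < 0, Literature.Analysis.FluidPDE.VectorCalculus.IsDivFree (v t)) →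
      (∃ s < 0, ∃ U : Set (EuclideanSpace ℝ (Fin 3)), IsOpen U ∧ U.Nonempty ∧ ∀ z ∈ U, F (v s z) (fderiv ℝ (v s) z) = 0) →
      ¬ Literature.Analysis.FluidPDE.IsBackwardSingularPoint v 0) :
    ∀ (ν T : ℝ), 0 < ν → 0 < T → ∀ (u : ℝ → (EuclideanSpace ℝ (Fin 3)) → (EuclideanSpace ℝ (Fin 3))) (p : ℝ → (EuclideanSpace ℝ (Fin 3)) → ℝ),
    Literature.Analysis.FluidPDE.IsClassicalNSSolutionOn (Set.Ico 0 T) ν 0 u p →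
    Literature.Analysis.FluidPDE.IsLerayHopfOn T ν 0 (u 0) u →
    Literature.Analysis.FluidPDE.HasRapidSpatialDecay (u 0) →
    ∀ (x₀ : (EuclideanSpace ℝ (Fin 3))) (ρ M : ℝ), 0 < ρ →
    (∀ t ∈ Set.Ico 0 T, T - ρ ^ 2 < t → ∀ x ∈ Metric.ball x₀ ρ, ‖u t x‖ * Real.sqrt (ν * (T - t)) ≤ M) →
    ∀ (U : Set (EuclideanSpace ℝ (Fin 3))), IsOpen U → U.Nonempty →
    ∀ (P : ℝ → Prop) (c : ℝ), 0 < c →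
    (∀ᶠ τ in nhdsWithin (0 : ℝ) (Set.Ioi 0), ∃ t' : ℝ, t' ∈ Set.Ico 0 T ∧ P t' ∧ c * τ ≤ T - t' ∧ T - t' ≤ τ) →
    (∀ t : ℕ → ℝ, (∀ k, t k ∈ Set.Ico 0 T ∧ P (t k)) → Filter.Tendsto t Filter.atTop (nhds T) →
      Filter.Tendsto (fun k => ∫⁻ y in U, ENNReal.ofReal
        |F (Real.sqrt (T - t k) • u (t k) (x₀ + Real.sqrt (T - t k) • y))
          (Real.sqrt (T - t k) ^ 2 • fderiv ℝ (u (t k)) (x₀ + Real.sqrt (T - t k) • y))|)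
        Filter.atTop (nhds 0)) →
    Literature.Analysis.FluidPDE.IsBackwardBoundedAt u T x₀ := by
  intro ν T hν hT u p hsol hLH _ x₀ ρ M hρ hM U hU hUne P c hc hband hfadeP
  by_contra hnotbd
  obtain ⟨C, v, sstar, σinf, t, hP, hsing, hsstar, hσinf, htk, htT, hconv⟩ :=
    bandWindowZoom hν hT hsol hLH hρ hM hnotbd P hc hband
  have hfade := hfadeP t htk htT
  refine hcrux C v hP.1 hP.2.1 hP.2.2.1 hP.2.2.2 ?_ hsing
  set W : ℕ → (EuclideanSpace ℝ (Fin 3)) → (EuclideanSpace ℝ (Fin 3)) := fun j y =>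
    Real.sqrt (T - t j) • u (t j) (x₀ + Real.sqrt (T - t j) • y) with hWdef
  set G : ℕ → (EuclideanSpace ℝ (Fin 3)) → ((EuclideanSpace ℝ (Fin 3)) →L[ℝ] (EuclideanSpace ℝ (Fin 3))) := fun j y =>
    Real.sqrt (T - t j) ^ 2 • fderiv ℝ (u (t j)) (x₀ + Real.sqrt (T - t j) • y) with hGdef
  set Hs : (EuclideanSpace ℝ (Fin 3)) → ℝ := fun y =>
    F ((σinf * ν) • v sstar (σinf • y)) ((σinf ^ 2 * ν) • fderiv ℝ (v sstar) (σinf • y)) with hHsdef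
  have han : AnalyticOnNhd ℝ (v sstar) univ :=
    analyticOnNhd_slice hP.2.1 (bdd_of_hasTypeITimeDecay hP.1) hP.2.2.1 hsstar
  have hvs : Continuous (v sstar) := by
    rw [← continuousOn_univ]; exact han.continuousOn
  have hDvs : Continuous (fderiv ℝ (v sstar)) := (han.contDiff (n := 1)).continuous_fderiv one_ne_zero
  have hHscont : Continuous Hs := by
    show Continuous fun y => F ((σinf * ν) • v sstar (σinf • y)) ((σinf ^ 2 * ν) • fderiv ℝ (v sstar) (σinf • y))
    exact hF.comp ((((hvs.comp (continuous_const_smul σinf)).const_smul (σinf * ν)).prodMk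
      ((hDvs.comp (continuous_const_smul σinf)).const_smul (σinf ^ 2 * ν))))
  have hconvH : ∀ y, Tendsto (fun j => F (W j y) (G j y)) atTop (𝓝 (Hs y)) := fun y =>
    (hF.tendsto _).comp ((hconv y).1.prodMk_nhds (hconv y).2)
  have hφc : ∀ j, Continuous fun y : (EuclideanSpace ℝ (Fin 3)) => x₀ + Real.sqrt (T - t j) • y :=
    fun j => continuous_const.add (continuous_const_smul _)
  have hWc : ∀ j, Continuous (W j) := fun j => by
    show Continuous fun y => Real.sqrt (T - t j) • u (t j) (x₀ + Real.sqrt (T - t j) • y)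
    exact ((hsol.contDiff_velocity (htk _).1).continuous.comp (hφc j)).const_smul (Real.sqrt (T - t j))
  have hGc : ∀ j, Continuous (G j) := fun j => by
    show Continuous fun y => Real.sqrt (T - t j) ^ 2 • fderiv ℝ (u (t j)) (x₀ + Real.sqrt (T - t j) • y)
    exact (((hsol.contDiff_velocity (htk _).1).continuous_fderiv (by norm_cast)).comp (hφc j)).const_smul
      (Real.sqrt (T - t j) ^ 2)
  have hFjc : ∀ j, Continuous fun y => F (W j y) (G j y) := fun j => hF.comp ((hWc j).prodMk (hGc j))
  -- ## FATOU on the window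
  set g : (EuclideanSpace ℝ (Fin 3)) → ℝ≥0∞ := fun y => ENNReal.ofReal |Hs y| with hg
  have hgc : Continuous g := ENNReal.continuous_ofReal.comp (continuous_abs.comp hHscont)
  have hgjm : ∀ j, Measurable fun y => ENNReal.ofReal |F (W j y) (G j y)| :=
    fun j => (ENNReal.continuous_ofReal.comp (continuous_abs.comp (hFjc j))).measurable
  have hptw : ∀ y, Tendsto (fun j => ENNReal.ofReal |F (W j y) (G j y)|) atTop (𝓝 (g y)) :=
    fun y => ENNReal.tendsto_ofReal ((continuous_abs.tendsto (Hs y)).comp (hconvH y))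
  have hFatou : ∫⁻ y in U, liminf (fun j => ENNReal.ofReal |F (W j y) (G j y)|) atTop ≤
      liminf (fun j => ∫⁻ y in U, ENNReal.ofReal |F (W j y) (G j y)|) atTop :=
    lintegral_liminf_le' (fun j => (hgjm j).aemeasurable)
  have hlim : (fun y => liminf (fun j => ENNReal.ofReal |F (W j y) (G j y)|) atTop) = g :=
    funext fun y => (hptw y).liminf_eq
  rw [hlim, hfade.liminf_eq] at hFatou
  have hint : ∫⁻ y in U, g y = 0 := le_antisymm hFatou bot_le
  have hae0 : ∀ᵐ y ∂(volume.restrict U), g y = 0 := (lintegral_eq_zero_iff hgc.measurable).1 hint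
  rw [ae_restrict_iff' hU.measurableSet] at hae0
  have hzeroU : ∀ y ∈ U, g y = 0 := by
    intro y hy
    by_contra hne
    set O : Set (EuclideanSpace ℝ (Fin 3)) := U ∩ g ⁻¹' (Ioi 0) with hO
    have hOo : IsOpen O := hU.inter (isOpen_Ioi.preimage hgc)
    have hO0 : volume O = 0 := by
      rw [measure_eq_zero_iff_ae_notMem]
      filter_upwards [hae0] with y' hy'
      rintro ⟨h1, h2⟩
      have := hy' h1
      simp only [mem_preimage, mem_Ioi, this, lt_self_iff_false] at h2
    have hOe : O = ∅ := (hOo.measure_eq_zero_iff volume).1 hO0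
    have hyO : y ∈ O := ⟨hy, by simpa [mem_preimage, mem_Ioi, pos_iff_ne_zero] using hne⟩
    rw [hOe] at hyO
    exact hyO
  refine ⟨sstar, hsstar, (fun z => σinf⁻¹ • z) ⁻¹' U, hU.preimage (continuous_const_smul σinf⁻¹), ?_, fun z hz => ?_⟩
  · obtain ⟨u₀, hu₀⟩ := hUne
    refine ⟨σinf • u₀, ?_⟩
    show σinf⁻¹ • (σinf • u₀) ∈ U
    rwa [smul_smul, inv_mul_cancel₀ hσinf.ne', one_smul]
  · have h := hzeroU (σinf⁻¹ • z) hz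
    simp only [hg, ENNReal.ofReal_eq_zero] at h
    have h0 : Hs (σinf⁻¹ • z) = 0 := abs_eq_zero.1 (le_antisymm h (abs_nonneg _))
    simp only [hHsdef, smul_smul, mul_inv_cancel₀ hσinf.ne', one_smul] at h0
    exact (hzero _ _ (mul_pos hσinf hν) (mul_pos (pow_pos hσinf 2) hν) _ _).1 h0

/-- **THE MOST-TIMES FIXED-DIRECTION SINE DOOR (unconditional).**  See the module docstring. -/
theorem mostTimesFixedDirectionDoor :
    ∀ (ν T : ℝ), 0 < ν → 0 < T → ∀ (u : ℝ → (EuclideanSpace ℝ (Fin 3)) → (EuclideanSpace ℝ (Fin 3))) (p : ℝ → (EuclideanSpace ℝ (Fin 3)) → ℝ),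
    Literature.Analysis.FluidPDE.IsClassicalNSSolutionOn (Set.Ico 0 T) ν 0 u p →
    Literature.Analysis.FluidPDE.IsLerayHopfOn T ν 0 (u 0) u →
    Literature.Analysis.FluidPDE.HasRapidSpatialDecay (u 0) →
    ∀ (x₀ : (EuclideanSpace ℝ (Fin 3))) (ρ M : ℝ), 0 < ρ →
    (∀ t ∈ Set.Ico 0 T, T - ρ ^ 2 < t → ∀ x ∈ Metric.ball x₀ ρ, ‖u t x‖ * Real.sqrt (ν * (T - t)) ≤ M) →
    ∀ (e : (EuclideanSpace ℝ (Fin 3))), e ≠ 0 → ∀ (U : Set (EuclideanSpace ℝ (Fin 3))), IsOpen U → U.Nonempty →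
    ∀ (E : Set ℝ), (∀ ε > 0, ∀ᶠ h in nhdsWithin (0 : ℝ) (Set.Ioi 0),
      MeasureTheory.volume (E ∩ Set.Ioo (T - h) T) ≤ ENNReal.ofReal (ε * h)) →
    (∀ t : ℕ → ℝ, (∀ k, t k ∈ Set.Ico 0 T ∧ t k ∉ E) → Filter.Tendsto t Filter.atTop (nhds T) →
      Filter.Tendsto (fun k => ∫⁻ y in U, ENNReal.ofReal
        ‖Literature.Analysis.FluidPDE.cross ((T - t k) • Literature.Analysis.FluidPDE.curl (u (t k))
          (x₀ + Real.sqrt (T - t k) • y)) e‖) Filter.atTop (nhds 0)) →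
    Literature.Analysis.FluidPDE.IsBackwardBoundedAt u T x₀ := by
  intro ν T hν hT u p hsol hLH hdec x₀ ρ M hρ hM e he U hU hUne E hE hfadeE
  have hF : Continuous fun q : (EuclideanSpace ℝ (Fin 3)) × ((EuclideanSpace ℝ (Fin 3)) →L[ℝ] (EuclideanSpace ℝ (Fin 3))) => ‖cross (curlCLM q.2) e‖ := by
    have h : Continuous fun q : (EuclideanSpace ℝ (Fin 3)) × ((EuclideanSpace ℝ (Fin 3)) →L[ℝ] (EuclideanSpace ℝ (Fin 3))) => (crossCLM.flip e) (curlCLM q.2) :=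
      (crossCLM.flip e).continuous.comp (curlCLM.continuous.comp continuous_snd)
    refine (continuous_norm.comp h).congr fun q => ?_
    simp only [Function.comp_apply, ContinuousLinearMap.flip_apply, crossCLM_apply]
  have hzero : ∀ (a b : ℝ), 0 < a → 0 < b → ∀ (x : (EuclideanSpace ℝ (Fin 3))) (A : (EuclideanSpace ℝ (Fin 3)) →L[ℝ] (EuclideanSpace ℝ (Fin 3))),
      ‖cross (curlCLM (b • A)) e‖ = 0 ↔ ‖cross (curlCLM A) e‖ = 0 := by
    intro a b _ hb x A
    have h : cross (curlCLM (b • A)) e = b • cross (curlCLM A) e := by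
      rw [map_smul, ← crossCLM_apply, ← crossCLM_apply, map_smul, smul_apply]
    rw [h, norm_smul, mul_eq_zero, Real.norm_eq_abs, abs_eq_zero, or_iff_right hb.ne']
  have hcrux : ∀ (C : ℝ) (v : ℝ → (EuclideanSpace ℝ (Fin 3)) → (EuclideanSpace ℝ (Fin 3))),
      Literature.Analysis.FluidPDE.HasTypeITimeDecay C v →
      ContinuousOn (Function.uncurry v) (Set.Iio (0 : ℝ) ×ˢ Set.univ) →
      (∀ s t : ℝ, s < t → t < 0 → ∀ x, v t x =
        Literature.Analysis.UnboundedOperators.heatExtension (v s) (t - s) x -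
          Literature.Analysis.FluidPDE.oseenDuhamel 1 s v v t x) →
      (∀ t < 0, Literature.Analysis.FluidPDE.VectorCalculus.IsDivFree (v t)) →
      (∃ s < 0, ∃ U : Set (EuclideanSpace ℝ (Fin 3)), IsOpen U ∧ U.Nonempty ∧
        ∀ z ∈ U, (fun (x : (EuclideanSpace ℝ (Fin 3))) (A : (EuclideanSpace ℝ (Fin 3)) →L[ℝ] (EuclideanSpace ℝ (Fin 3))) => ‖cross (curlCLM A) e‖) (v s z) (fderiv ℝ (v s) z) = 0) →
      ¬ Literature.Analysis.FluidPDE.IsBackwardSingularPoint v 0 := by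
    intro C v hrate hcont hmild hdiv hwin
    obtain ⟨s, hs, U', hU', hne', hal⟩ := hwin
    refine not_backwardSingular_of_zero (eq_zero_of_aligned_window hrate hcont hmild hdiv hs he hU' hne' ?_)
    intro z hz
    have h := hal z hz
    simp only [norm_eq_zero] at h
    rwa [← curl_eq_curlCLM] at h
  refine bandDoor_of_oneSliceWindowRigidity (fun x A => ‖cross (curlCLM A) e‖) hF hzero hcrux ν T hν hT u p hsol hLH hdec
    x₀ ρ M hρ hM U hU hUne (fun t' => t' ∉ E) (1 / 2) (by norm_num) (band_of_densityZero hT hE) fun t htk htT => ?_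
  refine (hfadeE t htk htT).congr fun k => ?_
  refine lintegral_congr fun y => ?_
  have ht : 0 ≤ T - t k := (sub_pos.2 (htk k).1.2).le
  rw [map_smul, ← curl_eq_curlCLM, Real.sq_sqrt ht, abs_norm]

end Summit.NavierStokesRegularity.NavierStokesRegularity.Theorems.LocalSineTubeDoorMostTimesFixedDirectionDoor

end
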